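import Mathlib.LinearAlgebra.UnitaryGroup
import Mathlib.LinearAlgebra.Matrix.Permutation
import Mathlib.Analysis.Complex.Basic
import Mathlib.Data.Matrix.Mul
import Mathlib.Order.Lattice.Nat
import HarnessLib

-- provenance: harness21/H21/H21/Prelude/CryptoQuantFine/QuantumQuery.lean @ 7f20f4c (interim HEAD d8f2665); M5 mechanical rewrite
/-!
# Quantum query algorithms and quantum query complexity

Trunk `CryptoQuantFine`, prelude item Q5 (notion `quantum_query_model`).

A `T`-query quantum algorithm on inputs `x : Fin N → Bool` acts on the Hilbert space with
computational basis `Fin N × Bool × W` (query index register, one target qubit, and a finite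
workspace `W`). It alternates fixed unitaries `U₀, …, U_T` with the query oracle
`O_x : |i, b, z⟩ ↦ |i, b ⊕ xᵢ, z⟩`; the final state is `U_T O_x U_{T-1} O_x ⋯ O_x U₀ |start⟩` and the
algorithm accepts with the Born probability of a fixed set of accepting basis states.
`Q_ε(f)` is the least `T` such that some `T`-query algorithm computes `f` with error `ε` on every
input (of a promise set `D`); `Q₂(f) = Q_{1/3}(f)` (bounded error) and `Q_E(f) = Q₀(f)` (exact).

Sources: R. Beals, H. Buhrman, R. Cleve, M. Mosca, R. de Wolf, *Quantum lower bounds by polynomials*,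
J. ACM 48 (2001), §2; H. Buhrman, R. de Wolf, *Complexity measures and decision tree complexity:
a survey*, Theoret. Comput. Sci. 288 (2002), §3.

Design choices.
* Unitaries are bundled as elements of `Matrix.unitaryGroup` (Mathlib), so no unitarity side
  conditions appear in statements.
* The query oracle is defined as the permutation matrix (`Equiv.Perm.permMatrix`, Mathlib) of the
  involution `(i, b, z) ↦ (i, b xor xᵢ, z)`; `queryOracle_apply` gives the explicit `0/1` entries and
  `queryOracle_mem_unitaryGroup` is then a real (short) proof.
* Measurement is a projective measurement in the computational basis onto `accept`; this is the
  BBCMW convention (measure, then output a fixed function of the outcome), specialised to Boolean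
  output.
* `QQueryAlg 0` is empty (the field `start : Fin 0 × …` has no inhabitant; `QQueryAlg.isEmpty`),
  matching the tacit assumption `N ≥ 1` of the sources. Consequently, for `N = 0` the defining set
  of `quantumQueryComplexityOn` is empty and the value is `sInf ∅ = 0`
  (`quantumQueryComplexityOn_zero_left`); this junk value coincides with the correct value `0`
  of `Q(f)` for a `0`-bit function, so it is harmless.
* `quantumQueryComplexityOn` is an `sInf` over `ℕ`; for `N ≠ 0` the set is nonempty whenever
  `0 ≤ ε` (`exists_computesWithError_zero`, `exists_computesWithError_of_nonneg`: `N` queries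
  always suffice), so no junk value arises for the error parameters used in statements (`0`, `1/3`).
  For `ε < 0` and `D` nonempty the set is empty and the value is the junk value `sInf ∅ = 0`.
  The bounds `quantumQueryComplexityOn_le` and `quantumQueryComplexityOn_anti` hold for all `N`
  (the `N = 0` case is handled separately via emptiness).
* Mathlib has no quantum query model (searched: `query`, `oracle`, `unitaryGroup` users); only
  `Matrix.unitaryGroup` and `Equiv.Perm.permMatrix` are reused.
-/

namespace Literature.Computability.Cryptography

open Matrix

/-- A quantum query algorithm on `N`-bit inputs (Beals–Buhrman–Cleve–Mosca–de Wolf 2001, §2):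
a finite workspace type `W`, a number of queries `T = queries`, unitaries `U₀, …, U_T` on the space
with basis `Fin N × Bool × W`, an initial basis state and a set of accepting basis states. [cite: Wolf2001, §2] -/
structure QQueryAlg (N : ℕ) where
  /-- The finite workspace basis. -/
  W : Type
  /-- The workspace basis is finite. -/
  [instFintype : Fintype W]
  /-- The workspace basis has decidable equality. -/
  [instDecEq : DecidableEq W]
  /-- The number `T` of oracle queries. -/
  queries : ℕ
  /-- The input-independent unitaries `U₀, …, U_T` interleaved with the queries. -/
  unitaries : Fin (queries + 1) → Matrix.unitaryGroup (Fin N × Bool × W) ℂ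
  /-- The initial computational-basis state. -/
  start : Fin N × Bool × W
  /-- The accepting outcomes of the final computational-basis measurement. -/
  accept : Set (Fin N × Bool × W)

attribute [instance] QQueryAlg.instFintype QQueryAlg.instDecEq

/-- There is no quantum query algorithm on `0` bits: the initial basis state would live in
`Fin 0 × Bool × W = ∅`. The sources (Beals et al. 2001, §2) tacitly assume `N ≥ 1`. [cite: BealsEtAl2001, §2] -/
theorem QQueryAlg.isEmpty : IsEmpty (QQueryAlg 0) :=
  ⟨fun A => A.start.1.elim0⟩

section Oracle

variable {N : ℕ} {W : Type*}

/-- The classical map underlying the query oracle: `(i, b, z) ↦ (i, b xor xᵢ, z)`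
(Beals et al. 2001, §2). [cite: BealsEtAl2001, §2] -/
def queryMap (x : Fin N → Bool) (s : Fin N × Bool × W) : Fin N × Bool × W :=
  (s.1, (s.2.1 ^^ x s.1), s.2.2)

/-- Unfolding lemma for `queryMap` (Beals et al. 2001, §2). [cite: BealsEtAl2001, §2] -/
@[simp]
theorem queryMap_apply (x : Fin N → Bool) (s : Fin N × Bool × W) :
    queryMap x s = (s.1, (s.2.1 ^^ x s.1), s.2.2) := rfl

/-- The query map is an involution: querying twice restores the target bit
(Beals et al. 2001, §2). [cite: BealsEtAl2001, §2] -/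
theorem queryMap_involutive (x : Fin N → Bool) : Function.Involutive (queryMap (W := W) x) := by
  rintro ⟨i, b, z⟩
  simp [queryMap]

/-- The query permutation of the basis `Fin N × Bool × W` induced by the input `x`
(Beals et al. 2001, §2). [cite: BealsEtAl2001, §2] -/
def queryPerm (x : Fin N → Bool) : Equiv.Perm (Fin N × Bool × W) :=
  (queryMap_involutive (W := W) x).toPerm _

/-- `queryPerm x` acts as `queryMap x` (Beals et al. 2001, §2). [cite: BealsEtAl2001, §2] -/
@[simp]
theorem queryPerm_apply (x : Fin N → Bool) (s : Fin N × Bool × W) :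
    queryPerm x s = queryMap x s := rfl

/-- The query permutation is its own inverse (Beals et al. 2001, §2). [cite: BealsEtAl2001, §2] -/
@[simp]
theorem queryPerm_inv (x : Fin N → Bool) : (queryPerm (W := W) x)⁻¹ = queryPerm x := by
  ext s : 1
  rw [Equiv.Perm.inv_def, Equiv.symm_apply_eq, queryPerm_apply, queryPerm_apply,
    queryMap_involutive]

variable [DecidableEq W]

/-- The quantum query oracle `O_x : |i, b, z⟩ ↦ |i, b ⊕ xᵢ, z⟩` as a matrix in the computational
basis `Fin N × Bool × W` (Beals–Buhrman–Cleve–Mosca–de Wolf 2001, §2; Buhrman–de Wolf 2002, §3).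
Defined as the permutation matrix of `queryPerm x`; see `queryOracle_apply` for the entries. [cite: Wolf2001, §2] -/
noncomputable def queryOracle (x : Fin N → Bool) :
    Matrix (Fin N × Bool × W) (Fin N × Bool × W) ℂ :=
  (queryPerm x).permMatrix ℂ

/-- Entries of the query oracle: `(O_x)_{s,t} = 1` iff `s` and `t` agree on the index and workspace
registers and `s`'s target bit is `t`'s target bit xor `x` at the queried index
(Beals et al. 2001, §2). [cite: BealsEtAl2001, §2] -/
@[simp]
theorem queryOracle_apply (x : Fin N → Bool) (s t : Fin N × Bool × W) :
    queryOracle x s t =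
      if s.1 = t.1 ∧ s.2.2 = t.2.2 ∧ s.2.1 = (t.2.1 ^^ x t.1) then 1 else 0 := by
  obtain ⟨i, b, z⟩ := s
  obtain ⟨j, c, w⟩ := t
  simp only [queryOracle, Equiv.Perm.permMatrix, PEquiv.toMatrix_apply, Equiv.toPEquiv_apply,
    Option.mem_def, Option.some.injEq, queryPerm_apply, queryMap_apply, Prod.mk.injEq]
  by_cases hij : i = j
  · subst hij
    by_cases hzw : z = w
    · subst hzw
      cases b <;> cases c <;> cases x i <;> simp
    · simp [hzw]
  · simp [hij]

/-- The query oracle is unitary (it is the permutation matrix of an involution)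
(Beals et al. 2001, §2). [cite: BealsEtAl2001, §2] -/
theorem queryOracle_mem_unitaryGroup [Fintype W] (x : Fin N → Bool) :
    queryOracle (W := W) x ∈ Matrix.unitaryGroup (Fin N × Bool × W) ℂ := by
  rw [Matrix.mem_unitaryGroup_iff, star_eq_conjTranspose, queryOracle,
    Matrix.conjTranspose_permMatrix, ← Matrix.permMatrix_mul, queryPerm_inv]
  have : queryPerm (W := W) x * queryPerm x = 1 := by
    nth_rw 1 [← queryPerm_inv (W := W) x]
    exact inv_mul_cancel _
  rw [this, Matrix.permMatrix_one]

end Oracle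

namespace QQueryAlg

variable {N : ℕ}

/-- The final state `U_T O_x U_{T-1} O_x ⋯ U₁ O_x U₀ |start⟩` of the query algorithm `A` on input `x`,
as a vector of amplitudes indexed by the computational basis (Beals et al. 2001, §2). [cite: BealsEtAl2001, §2] -/
noncomputable def finalState (A : QQueryAlg N) (x : Fin N → Bool) : Fin N × Bool × A.W → ℂ :=
  Fin.foldl A.queries
    (fun ψ j => (A.unitaries j.succ : Matrix _ _ ℂ) *ᵥ (queryOracle x *ᵥ ψ))
    ((A.unitaries 0 : Matrix _ _ ℂ) *ᵥ Pi.single A.start 1)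

open Classical in
/-- The acceptance probability of `A` on input `x`: the Born probability that the final
computational-basis measurement lands in `A.accept` (Beals et al. 2001, §2). [cite: BealsEtAl2001, §2] -/
noncomputable def acceptProb (A : QQueryAlg N) (x : Fin N → Bool) : ℝ :=
  ∑ s with s ∈ A.accept, ‖A.finalState x s‖ ^ 2

/-- `A` computes `f` with error (at most) `ε` on the promise set `D`: on every `x ∈ D` it outputs
`f x` with probability at least `1 - ε` (Beals et al. 2001, §2; Buhrman–de Wolf 2002, §3).
`ε = 0` is exact computation, `ε = 1/3` bounded-error computation. [cite: BealsEtAl2001, §2] -/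
def ComputesWithError (A : QQueryAlg N) (ε : ℝ) (D : Set (Fin N → Bool))
    (f : (Fin N → Bool) → Bool) : Prop :=
  ∀ x ∈ D, (f x = true → 1 - ε ≤ A.acceptProb x) ∧ (f x = false → A.acceptProb x ≤ ε)

/-- Acceptance probabilities are nonnegative (Beals et al. 2001, §2). [cite: BealsEtAl2001, §2] -/
theorem acceptProb_nonneg (A : QQueryAlg N) (x : Fin N → Bool) : 0 ≤ A.acceptProb x :=
  Finset.sum_nonneg fun _ _ => by positivity

/-- Acceptance probabilities are at most `1`, since all `Uⱼ` and `O_x` are unitary and `|start⟩` is a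
unit vector (Beals et al. 2001, §2). [cite: BealsEtAl2001, §2] -/
def acceptProb_le_one : Prop :=
  ∀ (A : QQueryAlg N) (x : Fin N → Bool),
    A.acceptProb x ≤ 1

/-- Weakening: more error and a smaller promise set are easier (Buhrman–de Wolf 2002, §3). [cite: Wolf2002, §3] -/
theorem ComputesWithError.mono {A : QQueryAlg N} {ε ε' : ℝ} {D D' : Set (Fin N → Bool)}
    {f : (Fin N → Bool) → Bool} (h : A.ComputesWithError ε D f) (hε : ε ≤ ε') (hD : D' ⊆ D) :
    A.ComputesWithError ε' D' f := fun x hx =>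
  ⟨fun hf => le_trans (by linarith) ((h x (hD hx)).1 hf),
    fun hf => le_trans ((h x (hD hx)).2 hf) hε⟩

end QQueryAlg

section Complexity

variable {N : ℕ}

/-- The `ε`-error quantum query complexity of `f` on the promise set `D`: the least number of
queries `T` of a quantum query algorithm computing `f` with error `ε` on every `x ∈ D`
(Buhrman–de Wolf 2002, §3; Beals et al. 2001, §2). For `N ≠ 0` the defining set is nonempty
whenever `0 ≤ ε` (`exists_computesWithError_of_nonneg`), so `sInf` takes no junk value there.
Junk values: for `N = 0` (no algorithm exists, `QQueryAlg.isEmpty`) the value is `sInf ∅ = 0`,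
which is the correct complexity of a `0`-bit function (`quantumQueryComplexityOn_zero_left`); for
`ε < 0` and `D` nonempty no algorithm qualifies, the set is empty and the value is `sInf ∅ = 0`. [cite: Wolf2002, §3] -/
noncomputable def quantumQueryComplexityOn (ε : ℝ) (D : Set (Fin N → Bool))
    (f : (Fin N → Bool) → Bool) : ℕ :=
  sInf {T | ∃ A : QQueryAlg N, A.queries = T ∧ A.ComputesWithError ε D f}

/-- The `ε`-error quantum query complexity `Q_ε(f)` of a total Boolean function `f` on `N` bits
(Buhrman–de Wolf 2002, §3; Beals et al. 2001, §2). The bounded-error measure `Q₂(f)` is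
`quantumQueryComplexity (1/3) f` and the exact measure `Q_E(f)` is `quantumQueryComplexity 0 f`;
no one-letter abbreviations are introduced. [cite: Wolf2002, §3] -/
noncomputable def quantumQueryComplexity (ε : ℝ) (f : (Fin N → Bool) → Bool) : ℕ :=
  quantumQueryComplexityOn ε Set.univ f

/-- The `N`-bit OR function, `OR(x) = true ↔ ∃ i, xᵢ = true` (Grover search as a decision problem;
Buhrman–de Wolf 2002, §3). [cite: Wolf2002, §3] -/
def orFn (N : ℕ) (x : Fin N → Bool) : Bool :=
  decide (∃ i, x i = true)

/-- `orFn N x = true` iff some bit of `x` is set (Buhrman–de Wolf 2002, §3). [cite: Wolf2002, §3] -/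
@[simp]
theorem orFn_eq_true_iff (x : Fin N → Bool) : orFn N x = true ↔ ∃ i, x i = true := by
  simp [orFn]

/-- Every Boolean function on `N` bits is computed exactly by an `N`-query quantum algorithm
(query all bits into the workspace, then apply a permutation reading off `f`)
(Beals et al. 2001, §2; Buhrman–de Wolf 2002, §3: `Q_E(f) ≤ D(f) ≤ N`). [cite: BealsEtAl2001, §2] -/
def exists_computesWithError_zero : Prop :=
  ∀ [NeZero N] (f : (Fin N → Bool) → Bool),
    ∃ A : QQueryAlg N, A.queries = N ∧ A.ComputesWithError 0 Set.univ f

/-- For `N ≠ 0` and `0 ≤ ε`, some `N`-query algorithm computes `f` with error `ε` on any promise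
set; in particular the set defining `quantumQueryComplexityOn ε D f` is nonempty
(Buhrman–de Wolf 2002, §3). [cite: Wolf2002, §3] -/
def exists_computesWithError_of_nonneg : Prop :=
  ∀ [NeZero N] {ε : ℝ} (hε : 0 ≤ ε) (D : Set (Fin N → Bool)) (f : (Fin N → Bool) → Bool),
    ∃ A : QQueryAlg N, A.queries = N ∧ A.ComputesWithError ε D f

/- interim proof relied on results that are now named facts (D-0014); demoted to a fact by the M5 import, proof preserved:
:= by
  obtain ⟨A, hA, h⟩ := exists_computesWithError_zero f
  exact ⟨A, hA, h.mono hε (Set.subset_univ D)⟩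
-/

/-- On `0` bits there is no query algorithm (`QQueryAlg.isEmpty`), so the defining set is empty and
`quantumQueryComplexityOn` takes the (correct) junk value `sInf ∅ = 0`
(cf. Buhrman–de Wolf 2002, §3). [cite: Wolf2002, §3] -/
theorem quantumQueryComplexityOn_zero_left (ε : ℝ) (D : Set (Fin 0 → Bool))
    (f : (Fin 0 → Bool) → Bool) : quantumQueryComplexityOn ε D f = 0 := by
  have h : {T | ∃ A : QQueryAlg 0, A.queries = T ∧ A.ComputesWithError ε D f} = ∅ :=
    Set.eq_empty_of_forall_notMem fun _ ⟨A, _, _⟩ => QQueryAlg.isEmpty.false A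
  rw [quantumQueryComplexityOn, h, Nat.sInf_empty]

/-- `Q_ε(f) ≤ N` on any promise set, for `0 ≤ ε` (Buhrman–de Wolf 2002, §3: `Q_E(f) ≤ D(f) ≤ N`).
Holds for all `N` (for `N = 0` both sides are `0`). [cite: Wolf2002, §3:  Q_E(f] -/
def quantumQueryComplexityOn_le : Prop :=
  ∀ (ε : ℝ) (hε : 0 ≤ ε) (D : Set (Fin N → Bool)) (f : (Fin N → Bool) → Bool),
    quantumQueryComplexityOn ε D f ≤ N

/- interim proof relied on results that are now named facts (D-0014); demoted to a fact by the M5 import, proof preserved: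
:= by
  rcases Nat.eq_zero_or_pos N with rfl | hN
  · rw [quantumQueryComplexityOn_zero_left]
  · haveI : NeZero N := NeZero.of_pos hN
    exact Nat.sInf_le (exists_computesWithError_of_nonneg hε D f :)
-/

/-- `Q_ε(f) ≤ N` for `0 ≤ ε` (Buhrman–de Wolf 2002, §3). [cite: Wolf2002, §3] -/
def quantumQueryComplexity_le : Prop :=
  ∀ (ε : ℝ) (hε : 0 ≤ ε) (f : (Fin N → Bool) → Bool),
    quantumQueryComplexity ε f ≤ N

/- interim proof relied on results that are now named facts (D-0014); demoted to a fact by the M5 import, proof preserved: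
:=
  quantumQueryComplexityOn_le ε hε Set.univ f
-/

/-- Monotonicity of quantum query complexity: it is antitone in the error `ε` and monotone in the
promise set `D` (allowing more error, or promising more about the input, can only help)
(Buhrman–de Wolf 2002, §3). The hypothesis `0 ≤ ε` excludes the junk regime `ε < 0`; the
statement holds for all `N` (for `N = 0` both sides are `0`). [cite: Wolf2002, §3] -/
def quantumQueryComplexityOn_anti : Prop :=
  ∀ {ε ε' : ℝ} (hε : 0 ≤ ε) (hεε' : ε ≤ ε') {D D' : Set (Fin N → Bool)} (hD : D' ⊆ D) (f : (Fin N → Bool) → Bool),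
    quantumQueryComplexityOn ε' D' f ≤ quantumQueryComplexityOn ε D f

/- interim proof relied on results that are now named facts (D-0014); demoted to a fact by the M5 import, proof preserved:
:= by
  rcases Nat.eq_zero_or_pos N with rfl | hN
  · rw [quantumQueryComplexityOn_zero_left, quantumQueryComplexityOn_zero_left]
  · haveI : NeZero N := NeZero.of_pos hN
    obtain ⟨A, hA, h⟩ := Nat.sInf_mem
      (s := {T | ∃ A : QQueryAlg N, A.queries = T ∧ A.ComputesWithError ε D f})
      ⟨N, exists_computesWithError_of_nonneg hε D f⟩
    exact Nat.sInf_le ⟨A, hA, h.mono hεε' hD⟩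
-/

/-- Quantum query complexity is antitone in the error parameter (Buhrman–de Wolf 2002, §3). [cite: Wolf2002, §3] -/
def quantumQueryComplexity_anti : Prop :=
  ∀ {ε ε' : ℝ} (hε : 0 ≤ ε) (hεε' : ε ≤ ε') (f : (Fin N → Bool) → Bool),
    quantumQueryComplexity ε' f ≤ quantumQueryComplexity ε f

/- interim proof relied on results that are now named facts (D-0014); demoted to a fact by the M5 import, proof preserved:
:=
  quantumQueryComplexityOn_anti hε hεε' subset_rfl f
-/

end Complexity

end Literature.Computability.Cryptography
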